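import Summits.MatrixMultiplication.OmegaCensus.BoxRatioSectionLaw
import Summits.MatrixMultiplication.OmegaCensus.CentreIndexFourGroups

/-!
# ω-census, family (b3): conjecture C9 (c), first two classes in the kernel — abelian and centre-index-4 groups are box-useful

HONEST FRAMING (pub-omega census; verbatim): lottery ticket; floor = certified bounds/negative ranges.  Census BOOKKEEPING for
the typed conjecture C9 (`BoxRatioSectionLaw.lean`): the converse direction for the classes `[G:Z(G)] = 1` and `[G:Z(G)] = 4`,
in the vocabulary of `BoxUseful`; nothing here is progress on `ω`.

* `BoxUseful.of_index_center_one`: an abelian finite group is box-useful — in a commutative group the cell word of `P, P'` is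
  `key P · (key P')⁻¹` (`key (x,y,w) = x y w`), so an independent cell set is mapped injectively into `G` by `key`:
  `|I| ≤ |G| < (9/5)|G|`.
* `BoxUseful.of_index_center_four`: a finite group with centre of index `4` is box-useful — the fibre argument of
  `CentreIndexFourTPP` run on an arbitrary independent cell set instead of a TPP box (`SmallComm.two_mul_card_indep_le`:
  `2|I| ≤ 3|G|`; the TPP hypothesis of `two_mul_volume_le` was used only to know that distinct cells have non-trivial word,
  which is what independence says), then `2|I| ≤ 3|G| ⇒ 5|I| < 9|G|`.
The classes `[G:Z] = 6` and `𝒞₂` need the corresponding fibre lemmas of `CentreIndexSixTPP` / `DihC3SqTPP` restated for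
independent sets; not done here.
-/

namespace Summit.MatrixMultiplication.OmegaCensus

open Finset ProductBoxBound

variable {G : Type*} [Group G]

/-- `ProductBoxBound.cellWord` and `CentreIndexFour.E` are the same word. [folklore] -/
theorem cellWord_eq_E [DecidableEq G] (P P' : G × G × G) : cellWord P P' = CentreIndexFour.E P P' := rfl

namespace CentreIndexFour.SmallComm

variable {z : G} (h : SmallComm z)
include h

/-- Fibre version for INDEPENDENT cell sets (cf. `E_eq_of_fibre` for TPP boxes): two distinct independent cells in one fibre
`{g, g z}` of `key` have word `z`. [folklore] -/
theorem E_eq_of_fibre_indep {I : Finset (G × G × G)} (hind : ∀ P ∈ I, ∀ P' ∈ I, P ≠ P' → E P P' ≠ 1) {g : G}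
    {P P' : G × G × G} (hP : P ∈ I) (hP' : P' ∈ I) (hne : P ≠ P')
    (hr : key P = g ∨ key P * z = g) (hr' : key P' = g ∨ key P' * z = g) : E P P' = z := by
  have hE1 : E P P' ≠ 1 := hind P hP P' hP' hne
  have hK : key P * (key P')⁻¹ = 1 ∨ key P * (key P')⁻¹ = z := by
    have lift : ∀ Q : G × G × G, key Q * z = g → key Q = g * z⁻¹ := fun Q e => by rw [← e]; group
    rcases hr with e | e <;> rcases hr' with e' | e'
    · left; rw [e, e']; group
    · right; rw [e, lift _ e']
      calc g * (g * z⁻¹)⁻¹ = g * z * g⁻¹ := by group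
        _ = z * g * g⁻¹ := by rw [h.central g]
        _ = z := by group
    · right; rw [lift _ e, e', h.inv_eq]
      calc g * z * g⁻¹ = z * g * g⁻¹ := by rw [h.central g]
        _ = z := by group
    · left; rw [lift _ e, lift _ e']; group
  obtain ⟨ζ, hζ, hKE⟩ := h.key_mul_inv_eq P P'
  rcases hζ with e | e <;> rw [e] at hKE <;> rcases hK with hK | hK <;> rw [hK] at hKE
  · exact absurd (by simpa using hKE.symm) hE1
  · simpa using hKE.symm
  · calc E P P' = E P P' * z * z⁻¹ := by group
      _ = z := by rw [← hKE, one_mul, h.inv_eq]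
  · have e' : E P P' * z = 1 * z := by rw [one_mul]; exact hKE.symm
    exact absurd (mul_right_cancel e') hE1

/-- **Box form of `two_mul_volume_le`.**  With `SmallComm z`, every independent cell set inside a box `G × Y × W` with
`#Y ≤ 3`, `#W ≤ 3` has `2·|I| ≤ 3·|G|` (fibres of `key` modulo `{1, z}` hold `≤ 3` cells each). [folklore] -/
theorem two_mul_card_indep_le [Fintype G] [DecidableEq G] {Y W : Finset G} (hY : #Y ≤ 3) (hW : #W ≤ 3)
    {I : Finset (G × G × G)} (hI : I ⊆ univ ×ˢ (Y ×ˢ W)) (hind : ∀ P ∈ I, ∀ P' ∈ I, P ≠ P' → E P P' ≠ 1) :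
    2 * #I ≤ 3 * Fintype.card G := by
  classical
  let r : (G × G × G) → G → Prop := fun P g => key P = g ∨ key P * z = g
  have hL : ∀ P ∈ I, #((univ : Finset G).bipartiteAbove r P) = 2 := by
    intro P _
    have hset : (univ : Finset G).bipartiteAbove r P = {key P * z, key P} := by
      ext g
      simp only [bipartiteAbove, mem_filter, mem_univ, true_and, mem_insert, mem_singleton, r]
      constructor
      · rintro (e | e); exacts [Or.inr e.symm, Or.inl e.symm]
      · rintro (e | e); exacts [Or.inr e.symm, Or.inl e.symm]
    rw [hset, card_insert_of_notMem, card_singleton]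
    simp only [mem_singleton]
    intro e
    exact h.ne_one (by
      calc z = (key P)⁻¹ * (key P * z) := by group
        _ = 1 := by rw [e]; group)
  have hR : ∀ g ∈ (univ : Finset G), #(I.bipartiteBelow r g) ≤ 3 := by
    intro g _
    refine h.fibre_card_le_three hY hW (J := I.bipartiteBelow r g) ?_ ?_ ?_
    · intro P hP
      have := hI (mem_filter.1 hP).1; rw [mem_product, mem_product] at this; exact this.2.1
    · intro P hP
      have := hI (mem_filter.1 hP).1; rw [mem_product, mem_product] at this; exact this.2.2
    · intro P hP P' hP' hne
      exact h.E_eq_of_fibre_indep hind (mem_filter.1 hP).1 (mem_filter.1 hP').1 hne (mem_filter.1 hP).2 (mem_filter.1 hP').2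
  calc 2 * #I = ∑ P ∈ I, #((univ : Finset G).bipartiteAbove r P) := by rw [sum_const_nat hL, mul_comm]
    _ = ∑ g ∈ (univ : Finset G), #(I.bipartiteBelow r g) := sum_card_bipartiteAbove_eq_sum_card_bipartiteBelow _
    _ ≤ ∑ g ∈ (univ : Finset G), 3 := sum_le_sum hR
    _ = 3 * Fintype.card G := by rw [sum_const, card_univ, smul_eq_mul, mul_comm]

end CentreIndexFour.SmallComm

/-- **C9 (c), class `[G:Z(G)] = 4`, in the kernel.** A finite group with centre of index `4` is box-useful
(`2|I| ≤ 3|G| < (18/5)|G|`). [folklore] -/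
theorem BoxUseful.of_index_center_four [Fintype G] [DecidableEq G] (h4 : (Subgroup.center G).index = 4) :
    BoxUseful G := by
  intro Y W hY hW I hI hind
  obtain ⟨z, hz⟩ := CentreIndexFour.exists_smallComm h4
  have h2 := hz.two_mul_card_indep_le hY.le hW.le hI (fun P hP P' hP' hne => by
    rw [← cellWord_eq_E]; exact hind P hP P' hP' hne)
  have hpos : 0 < Fintype.card G := Fintype.card_pos
  omega

/-- **C9 (c), class `[G:Z(G)] = 1` (abelian), in the kernel.** An abelian finite group is box-useful (`|I| ≤ |G|`, the
product map `key` being injective on an independent cell set). [folklore] -/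
theorem BoxUseful.of_index_center_one [Fintype G] [DecidableEq G] (h1 : (Subgroup.center G).index = 1) :
    BoxUseful G := by
  intro Y W hY hW I hI hind
  have htop : Subgroup.center G = ⊤ := Subgroup.index_eq_one.1 h1
  have hc : ∀ a b : G, a * b = b * a := fun a b => by
    have ha : a ∈ Subgroup.center G := by rw [htop]; exact Subgroup.mem_top a
    exact ((Subgroup.mem_center_iff.1 ha) b).symm
  -- in a commutative group the cell word is `key P · (key P')⁻¹`
  have hword : ∀ P P' : G × G × G, cellWord P P' = (P.1 * P.2.1 * P.2.2) * (P'.1 * P'.2.1 * P'.2.2)⁻¹ := by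
    letI : CommGroup G := { ‹Group G› with mul_comm := hc }
    intro P P'
    simp only [cellWord, mul_inv_rev]
    simp only [mul_assoc, mul_comm, mul_left_comm]
  have hinj : Set.InjOn (fun P : G × G × G => P.1 * P.2.1 * P.2.2) ↑I := by
    intro P hP P' hP' heq
    by_contra hne
    apply hind P hP P' hP' hne
    rw [hword]; simp only at heq; rw [heq, mul_inv_cancel]
  have hle : #I ≤ Fintype.card G := by
    rw [← Finset.card_univ]
    exact Finset.card_le_card_of_injOn _ (fun _ _ => Finset.mem_univ _) hinj
  have hpos : 0 < Fintype.card G := Fintype.card_pos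
  omega

end Summit.MatrixMultiplication.OmegaCensus
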